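import Summits.BirchSwinnertonDyer.Rank1Residual.GaloisImage.KatoKuriharaPortThree
import HarnessLib

/-!
# DICT3 @ 3 in universal-closure form WITH A SHARED GENERATOR — the repaired PORT′
# (cell `b2b-bsdres`, team n1011; lead R5-110 (n3)(β); planner r1 GEN 47 spec (R-ii); anomaly by
# n1011-p11 GEN 11; typer = the PORT's owning lineage, seat p18 GEN 10)

HONEST FRAMING (run/shared/lean/b2b/bsd-rank1-residual/, verbatim in every file): the goal of the
cell is to DELETE the COMBINATION-SHAPED residual classes of the Birch–Swinnerton-Dyer formula for
ALL analytic-rank `≤ 1` elliptic curves over `ℚ` — "full BSD formula for every rank `≤ 1` curve in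
class `C`" assembled STRICTLY from published theorems — so that the rank-`≤ 1` remainder becomes
exactly the CONSTRUCTION-SHAPED classes, which are TYPED (missing-input `Prop`s), NOT attempted.
This is not "finishing BSD". Team n1011 (N10/N11, the additive block `X4 ∧ p = 3`): research
route; no claim beyond the stated classes; the label X4 and the mark of RESIDUAL-MAP §I N11 are
UNCHANGED by this file; nothing is booked.  TWO definitions — a datum-shape predicate WITH AN
EXPLICIT generator `η` and the repaired PORT′ (a typed MISSING-INPUT predicate; FLAG
`K22-Thm3.13-PORT@3`, NOT in print at `3`, to be ASSUMED by its consumer, never `_holds`; ledger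
rider R-a: the SAME debt line as DICT3 / DICT3₁ / DICT3₂ / PORT, not a new one) — and the unpacking
and guard lemmas; no named fact is minted; nothing is asserted.

## Why (the anomaly of record, n1011-p11 GEN 11, 2026-08-22T09:48Z; CONFIRMED by planner r1 GEN 47,
`cells/n1011/route1/g47_port_anomaly_check.md` 6dd3cdc1212252f6, and by the author lineage, R5-110 (n1))

The PORT of `KatoKuriharaPortThree.lean` (`KatoKuriharaPortThreeAt W t v₃`, this lineage's FILE C of
T-R1-45 = planner r1's R1-45 (b) wording "ONE port hypothesis in universal-closure form, quantified
over all depths and all data inside the right class") binds `∀ k k' D D' red` with the two guards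
`IsCanonicalTauDatumThreeAt` as INDEPENDENT antecedents, and each guard seals its OWN generator
(`∃ η, D.HasCanonicalComparison (3^{j+1}) η`).  Nothing ties `D′`'s generators to `D`'s, so the
closure also ranges over two canonical `τ`-data on ONE prime set for `η` and for `η⁻¹`
(`FSComp.Rat.exists_kolyvaginDatum_hasCanonicalComparison_frobeniusClassPrimes` takes `η` as an INPUT,
`zpowers (η q) = ⊤` is invariant under `η ↦ η⁻¹`); at `k = k′` the pinned reduction is `id` and
DICT3₂'s (COMP) clause compares the two derivative families level by level — but Kolyvagin
derivative classes and the canonical finite–singular comparison maps BOTH change sign with the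
generator (p11's local lemma: canonical-for-`η⁻¹` `= −`(canonical-for-`η`) on `H¹_ur` at a `τ`-class
prime), whence `2·fs(loc_ℓ κ_∅) = 0`, `loc_ℓ κ_∅ = 0` on the whole class, contradicting the prime-choice
lemma once `κ_∅ ≠ 0` (a unit Kurihara value).  So the universal-closure PORT is UNSATISFIABLE on its
own population and the 59 records displaying `hPort : KatoKuriharaPortThreeAt …` are VACUOUS AS
DISPLAYED (they never closed anything; ledger negative N-PORT-1; kernel refutation = p11's ROW
T-PORT-NEG).  Every CONSTRUCTOR in the tree in fact uses ONE generator for all its data (the END-m2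
chain builds `D₉` and `D₃` with the same `η`; the corollary's tower family `TowerPackage.exists_towerFamily`
fixes one `η`; D7 demands one `σ` for both depths) — the closure dropped it.

## What (planner r1's REPAIR SPEC (R-ii), lead R5-110 (n3)(β): "the same closure with a SHARED η
exposed in the guard; PORT → PORT′ trivial; … a TYPER task for the PORT's owning lineage, ONE file")

* `KolyvaginDatum.IsCanonicalTauDatumThreeAtWith W m j η D` — the shape guard of
  `KatoKuriharaPortThree.lean` with the comparison clause `D.HasCanonicalComparison (3^{j+1}) η` for
  the GIVEN `η : (q : HeightOneSpectrum (𝓞 ℚ)) → (ZMod (N q))ˣ` (indexed by primes, not by the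
  modulus, so ONE `η` serves all depths); everything else (cyclotomic transverse conditions, primes
  inside a Sakamoto `τ`-class through `E[3^{m+1}]` off a set containing the bad places and the
  places above `3`) token for token.
* `KatoKuriharaPortThreeAtWith W t v₃ η` — PORT′: for ALL depths `k, k′`, ALL data `D` (depth
  `k`, With-guard at `m = k + t`) and `D′` (depth `k′`, With-guard at `m = k′ + t`) canonical for THE
  SAME `η`, and every `red`: `KatoKuriharaDictionaryThreeAt₂ W t k k′ D D′ red v₃` (p09's DICT3₂,
  unchanged; its antecedents `k ≤ k′`, `Addv`, `3 ∤ c₃`, surj(3), `#E(ℚ₃)[3] = 3^t`, `v₃ ∣ 3`, the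
  parametrisation datum and the pinned `red` stay INSIDE it).  The sign mechanism cannot touch
  PORT′: two data canonical for the same `η` have the same comparison maps at common primes, so
  (COMP) at `k = k′`, `red = id` is met by equal witnesses — PORT′'s standing is DICT3₂'s (one Euler
  system, one generator = D7's shape).  Its producer-to-be: ★ PK-6₂ re-targeted (R5-110 (n3)(γ)).
* `IsCanonicalTauDatumThreeAtWith.forget` — a With-guarded datum is guarded (forget `η`);
  `KatoKuriharaPortThreeAt.toWith` — PORT ⟹ PORT′ `η` for every `η`, ONE line (so nothing landed is
  contradicted and no displayed-PORT record is re-filed by this file);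
  `KatoKuriharaPortThreeAtWith.dictionary₂` — unpacking PORT′ to the END theorems' binder `hdict`
  for a shallow datum and deep data ALL canonical for the same `η` (the one-binder re-key of
  `KuriharaRecordCorollaryThree[Deep]` consumes exactly this);
  `isCanonicalTauDatumThreeAtWith_of_primes_eq` / `…_of_primes_eq_deep` /
  `IsCanonicalTauDatumThreeAtWith.of_primes_subset` — the With-guard from the tree's constructors'
  output (pinned class / deep class / sub-data), `η` explicit.

What is NOT here: any proof or instance of PORT′ (`_holds`); the refutation of PORT (p11's T-PORT-NEG);
any re-keyed END or record (post-week decision on the typer's cost estimate, R5-110 (n3)(β)).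

References: [Kim2022StructureSelmer] Thm. 3.13, §2.2.2, §3.3–§3.4.1 (arXiv pp. 12, 17–18);
[MazurRubin2004] Def. 3.1.3, Thm. 3.2.4, App. A (33); [Kato2004Asterisque] Thm. 12.5 (1);
[Sakamoto2024] §2 (the set `𝒫`, (H.2)), Def. 4.1; cells/n1011/ROUTE-1.md §27.6 R1-45 (b), §59;
cells/n1011/PLAN.md R5-110 (n1)–(n4); `HOME/b2b-bsdres-n1011-p11/gen11/PORT-ANOMALY.md`;
`cells/n1011/route1/g47_port_anomaly_check.md`.
-/

noncomputable section

open scoped Classical NumberField ContRepresentation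
open Field NumberField IsDedekindDomain WeierstrassCurve
  Literature.NumberTheory.EllipticCurves Literature.NumberTheory.EllipticCurves.ModularForms
  Literature.NumberTheory.EllipticCurves.Rank1Residual
  Literature.NumberTheory.GaloisRepresentations
  Literature.NumberTheory.GaloisRepresentations.DiscreteGaloisModule Literature.NumberTheory.GaloisCohomology

namespace Summit.BirchSwinnertonDyer.Rank1Residual.GaloisImage

/-- **Shape guard WITH an explicit generator: a canonical `τ`-datum for `E[3^{j+1}]`, canonical for
the GIVEN `η`, with primes in the class of depth `m`.**  `D.transverse` = the cyclotomic transverse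
conditions; `D.HasCanonicalComparison (3^{j+1}) η` — THE canonical finite–singular comparison maps for
THIS `η` (which includes `⟨η_𝔮⟩ = (ℤ/N𝔮)ˣ` at every `𝔮 ∈ 𝒫(D)`); and `𝒫(D) ⊆ frobeniusClassPrimes
ρ_{E,3^{m+1}} S τ 3^{m+1}` for SOME `S` all of whose outside places are good and prime to `3` and SOME
`τ ∈ Gal(ℚ̄/ℚ(μ_{3^{m+1}}))` with (H.2) `E[3^{m+1}]/(τ − 1) ≃ ℤ/3^{m+1}` (`m = j`: pinned, `m = j + t`:
the deep class of (B6)).  The only change against `IsCanonicalTauDatumThreeAt` is that `η` is a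
PARAMETER instead of being sealed under `∃` (planner r1 GEN 47 (R-ii); lead R5-110 (n3)(β)).
[cite: Sakamoto2024, §2 (the set 𝒫 and (H.2), pp. 920–921) and Def. 4.1]
[cite: Kim2022StructureSelmer, §1.2.2 and §2.1.2] [cite: MazurRubin2004, Def. 1.2.2 and Lemma 1.2.3] -/
def _root_.Literature.NumberTheory.GaloisCohomology.KolyvaginDatum.IsCanonicalTauDatumThreeAtWith
    (W : WeierstrassCurve ℚ) [W.IsElliptic] (m j : ℕ)
    (η : (q : HeightOneSpectrum (𝓞 ℚ)) → (ZMod (Ideal.absNorm q.asIdeal))ˣ)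
    (D : KolyvaginDatum (W.torsionGaloisModule (((3 : ℕ) : ℤ) ^ j * ((3 : ℕ) : ℤ)))) : Prop :=
  D.transverse = cyclotomicTransverse (W.torsionGaloisModule (((3 : ℕ) : ℤ) ^ j * ((3 : ℕ) : ℤ))) ∧
  D.HasCanonicalComparison (3 ^ (j + 1)) η ∧
  ∃ (S : Set (HeightOneSpectrum (𝓞 ℚ))) (τ : absoluteGaloisGroup ℚ),
    (∀ v ∉ S, W.HasGoodReductionAt v ∧ ((3 : ℕ) : 𝓞 ℚ) ∉ v.asIdeal) ∧
    τ ∈ rootsOfUnityFixer ℚ (3 ^ (m + 1)) ∧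
    Nonempty (cokerSubOne (W.torsionGaloisModule (((3 : ℕ) : ℤ) ^ m * ((3 : ℕ) : ℤ))) τ ≃+
      ZMod (3 ^ (m + 1))) ∧
    D.primes ⊆ frobeniusClassPrimes (W.torsionGaloisModule (((3 : ℕ) : ℤ) ^ m * ((3 : ℕ) : ℤ)))
      S τ (3 ^ (m + 1))

/-- **PORT′ — DICT3 @ 3 in universal-closure form WITH A SHARED GENERATOR (FLAG
`K22-Thm3.13-PORT@3`; NOT in print at `3`; a missing-input predicate, to be ASSUMED by its consumer,
never `_holds`; ledger rider R-a: the SAME debt line as `KatoKuriharaDictionaryThreeAt` / `…OneAt` /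
`…At₂` / `KatoKuriharaPortThreeAt`).**  For `W/ℚ` globally minimal, the `3`-torsion exponent `t`, a
place `v₃` and ONE choice of generators `η` (`η_𝔮 ∈ (ℤ/N𝔮)ˣ` per prime): for ALL depths `k, k′`, ALL
`τ`-data `D` for `E[3^{k+1}]` and `D′` for `E[3^{k′+1}]` canonical for THE SAME `η`, with primes in
the classes of depth `k + t`, `k′ + t` ((B6); at `t = 0` the pinned ones), and every reduction map
`red` (pinned to `x ↦ 3^{k′−k}·x` inside), p09's two-level dictionary
`KatoKuriharaDictionaryThreeAt₂ W t k k′ D D′ red v₃` holds.  Repair of the universal-closure PORT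
(lead R5-110 (n3)(β), planner r1 GEN 47 (R-ii)): two data canonical for the same `η` agree on their
comparison maps at common primes, so the generator-sign mechanism of n1011-p11's anomaly (which makes
`KatoKuriharaPortThreeAt` unsatisfiable on its population) does not apply; PORT′'s standing is
DICT3₂'s — one Euler system, one generator.  Nothing asserted.
[cite: Kim2022StructureSelmer, Thm. 3.13 and §2.2.2, §3.3–§3.4.1 (arXiv pp. 12, 17–18)]
[cite: MazurRubin2004, Def. 3.1.3, Thm. 3.2.4 and App. A (33)] [cite: Kato2004Asterisque, Thm. 12.5 (1)] -/
def KatoKuriharaPortThreeAtWith (W : WeierstrassCurve ℚ) [W.IsElliptic] [W.IsGloballyMinimal]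
    (t : ℕ) (v₃ : HeightOneSpectrum (𝓞 ℚ))
    (η : (q : HeightOneSpectrum (𝓞 ℚ)) → (ZMod (Ideal.absNorm q.asIdeal))ˣ) : Prop :=
  ∀ (k k' : ℕ) (D : KolyvaginDatum (W.torsionGaloisModule (((3 : ℕ) : ℤ) ^ k * ((3 : ℕ) : ℤ))))
    (D' : KolyvaginDatum (W.torsionGaloisModule (((3 : ℕ) : ℤ) ^ k' * ((3 : ℕ) : ℤ))))
    (red : (W.torsionGaloisModule (((3 : ℕ) : ℤ) ^ k' * ((3 : ℕ) : ℤ))).toContRepresentation →ⁱL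
      (W.torsionGaloisModule (((3 : ℕ) : ℤ) ^ k * ((3 : ℕ) : ℤ))).toContRepresentation),
    D.IsCanonicalTauDatumThreeAtWith W (k + t) k η → D'.IsCanonicalTauDatumThreeAtWith W (k' + t) k' η →
      KatoKuriharaDictionaryThreeAt₂ W t k k' D D' red v₃

variable {W : WeierstrassCurve ℚ} [W.IsElliptic]

/-- **A With-guarded datum is guarded** (seal the generator back under `∃`): the With-guard refines
`IsCanonicalTauDatumThreeAt`. [cite: Sakamoto2024, §2 and Def. 4.1] -/
theorem _root_.Literature.NumberTheory.GaloisCohomology.KolyvaginDatum.IsCanonicalTauDatumThreeAtWith.forget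
    {m j : ℕ} {η : (q : HeightOneSpectrum (𝓞 ℚ)) → (ZMod (Ideal.absNorm q.asIdeal))ˣ}
    {D : KolyvaginDatum (W.torsionGaloisModule (((3 : ℕ) : ℤ) ^ j * ((3 : ℕ) : ℤ)))}
    (hD : D.IsCanonicalTauDatumThreeAtWith W m j η) : D.IsCanonicalTauDatumThreeAt W m j := by
  obtain ⟨hT, hC, S, τ, hS, hτμ, hτq, hP⟩ := hD
  exact ⟨hT, ⟨η, hC⟩, S, τ, hS, hτμ, hτq, hP⟩

/-- **PORT ⟹ PORT′ `η` for every `η`** (one line: the shared-generator closure is a SPECIAL CASE of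
the universal closure) — so this file contradicts nothing landed, and the refutation of PORT
(n1011-p11's T-PORT-NEG) does not touch PORT′. [cite: Kim2022StructureSelmer, Thm. 3.13] -/
theorem KatoKuriharaPortThreeAt.toWith [W.IsGloballyMinimal] {t : ℕ} {v₃ : HeightOneSpectrum (𝓞 ℚ)}
    (h : KatoKuriharaPortThreeAt W t v₃)
    (η : (q : HeightOneSpectrum (𝓞 ℚ)) → (ZMod (Ideal.absNorm q.asIdeal))ˣ) :
    KatoKuriharaPortThreeAtWith W t v₃ η :=
  fun k k' D D' red hD hD' => h k k' D D' red hD.forget hD'.forget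

/-- **Unpacking PORT′ to the END theorem's binder `hdict`**: for a shallow datum `D` at depth `k`
and deep data `D′ k′` at every depth, ALL canonical for the SAME `η`, PORT′ gives
`∀ k′, k ≤ k′ → KatoKuriharaDictionaryThreeAt₂ W t k k′ D (D′ k′) (red k′) v₃` — the binder of
`Assembly.padicValRat_le_of_kolyvaginProduct_of_card_torsion_le` and of the record corollaries
`KuriharaRecordCorollaryThree[Deep]` (whose tower family already fixes one `η`: their re-key is this
one binder). [cite: Kim2022StructureSelmer, Thm. 3.13] -/
theorem KatoKuriharaPortThreeAtWith.dictionary₂ [W.IsGloballyMinimal] {t : ℕ}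
    {v₃ : HeightOneSpectrum (𝓞 ℚ)} {η : (q : HeightOneSpectrum (𝓞 ℚ)) → (ZMod (Ideal.absNorm q.asIdeal))ˣ}
    (h : KatoKuriharaPortThreeAtWith W t v₃ η) {k : ℕ}
    {D : KolyvaginDatum (W.torsionGaloisModule (((3 : ℕ) : ℤ) ^ k * ((3 : ℕ) : ℤ)))}
    (hD : D.IsCanonicalTauDatumThreeAtWith W (k + t) k η)
    {D' : ∀ k' : ℕ, KolyvaginDatum (W.torsionGaloisModule (((3 : ℕ) : ℤ) ^ k' * ((3 : ℕ) : ℤ)))}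
    (hD' : ∀ k', (D' k').IsCanonicalTauDatumThreeAtWith W (k' + t) k' η)
    (red : ∀ k' : ℕ, (W.torsionGaloisModule (((3 : ℕ) : ℤ) ^ k' * ((3 : ℕ) : ℤ))).toContRepresentation
      →ⁱL (W.torsionGaloisModule (((3 : ℕ) : ℤ) ^ k * ((3 : ℕ) : ℤ))).toContRepresentation) :
    ∀ k', k ≤ k' → KatoKuriharaDictionaryThreeAt₂ W t k k' D (D' k') (red k') v₃ :=
  fun k' _ => h k k' D (D' k') (red k') hD (hD' k')

/-- **A pinned canonical `τ`-datum passes the With-guard at its own depth** (`m = j = k`): the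
output shape of `FSComp.exists_eta_kolyvaginDatum_hasCanonicalComparison_frobeniusClassPrimes` with
`S ⊇ {bad} ∪ {v ∣ 3}`, the generator `η` kept EXPLICIT. [cite: Sakamoto2024, §2 and Def. 4.1] -/
theorem isCanonicalTauDatumThreeAtWith_of_primes_eq {k : ℕ}
    {D : KolyvaginDatum (W.torsionGaloisModule (((3 : ℕ) : ℤ) ^ k * ((3 : ℕ) : ℤ)))}
    {S : Set (HeightOneSpectrum (𝓞 ℚ))}
    (hS : ∀ v ∉ S, W.HasGoodReductionAt v ∧ ((3 : ℕ) : 𝓞 ℚ) ∉ v.asIdeal)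
    {τ : absoluteGaloisGroup ℚ} (hτμ : τ ∈ rootsOfUnityFixer ℚ (3 ^ (k + 1)))
    (hτq : Nonempty (cokerSubOne (W.torsionGaloisModule (((3 : ℕ) : ℤ) ^ k * ((3 : ℕ) : ℤ))) τ ≃+
      ZMod (3 ^ (k + 1))))
    (hP : D.primes = frobeniusClassPrimes (W.torsionGaloisModule (((3 : ℕ) : ℤ) ^ k * ((3 : ℕ) : ℤ)))
      S τ (3 ^ (k + 1)))
    (hT : D.transverse = cyclotomicTransverse (W.torsionGaloisModule (((3 : ℕ) : ℤ) ^ k * ((3 : ℕ) : ℤ))))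
    {η : (q : HeightOneSpectrum (𝓞 ℚ)) → (ZMod (Ideal.absNorm q.asIdeal))ˣ}
    (hD : D.HasCanonicalComparison (3 ^ (k + 1)) η) :
    D.IsCanonicalTauDatumThreeAtWith W k k η :=
  ⟨hT, hD, S, τ, hS, hτμ, hτq, hP.le⟩

/-- **A canonical `τ`-datum with primes in a DEEPER class passes the With-guard at that depth** (the
output shape of p15's deep constructor `S24Deep.exists_eta_kolyvaginDatum_torsion_pow_mul_deep`:
datum for `E[3^{k+1}]`, primes = the class through `E[3^{m+1}]`, `k ≤ m`; `η` EXPLICIT).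
[cite: Sakamoto2024, §2 and Def. 4.1] -/
theorem isCanonicalTauDatumThreeAtWith_of_primes_eq_deep {k m : ℕ}
    {D : KolyvaginDatum (W.torsionGaloisModule (((3 : ℕ) : ℤ) ^ k * ((3 : ℕ) : ℤ)))}
    {S : Set (HeightOneSpectrum (𝓞 ℚ))}
    (hS : ∀ v ∉ S, W.HasGoodReductionAt v ∧ ((3 : ℕ) : 𝓞 ℚ) ∉ v.asIdeal)
    {τ : absoluteGaloisGroup ℚ} (hτμ : τ ∈ rootsOfUnityFixer ℚ (3 ^ (m + 1)))
    (hτq : Nonempty (cokerSubOne (W.torsionGaloisModule (((3 : ℕ) : ℤ) ^ m * ((3 : ℕ) : ℤ))) τ ≃+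
      ZMod (3 ^ (m + 1))))
    (hP : D.primes = frobeniusClassPrimes (W.torsionGaloisModule (((3 : ℕ) : ℤ) ^ m * ((3 : ℕ) : ℤ)))
      S τ (3 ^ (m + 1)))
    (hT : D.transverse = cyclotomicTransverse (W.torsionGaloisModule (((3 : ℕ) : ℤ) ^ k * ((3 : ℕ) : ℤ))))
    {η : (q : HeightOneSpectrum (𝓞 ℚ)) → (ZMod (Ideal.absNorm q.asIdeal))ˣ}
    (hD : D.HasCanonicalComparison (3 ^ (k + 1)) η) :
    D.IsCanonicalTauDatumThreeAtWith W m k η :=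
  ⟨hT, hD, S, τ, hS, hτμ, hτq, hP.le⟩

/-- **Sub-data inherit the With-guard's prime clause**: if `𝒫(D′) ⊆ 𝒫(D)` for a With-guarded `D`
(depth of class `m`, any generator) and `D′` has the cyclotomic transverse conditions and the
canonical comparison maps for `η′`, then `D′` is With-guarded at depth `m` for `η′`.
[cite: Sakamoto2024, §2 and Def. 4.1] -/
theorem _root_.Literature.NumberTheory.GaloisCohomology.KolyvaginDatum.IsCanonicalTauDatumThreeAtWith.of_primes_subset
    {m j j' : ℕ} {η η' : (q : HeightOneSpectrum (𝓞 ℚ)) → (ZMod (Ideal.absNorm q.asIdeal))ˣ}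
    {D : KolyvaginDatum (W.torsionGaloisModule (((3 : ℕ) : ℤ) ^ j * ((3 : ℕ) : ℤ)))}
    (hD : D.IsCanonicalTauDatumThreeAtWith W m j η)
    {D' : KolyvaginDatum (W.torsionGaloisModule (((3 : ℕ) : ℤ) ^ j' * ((3 : ℕ) : ℤ)))}
    (hPP : D'.primes ⊆ D.primes)
    (hT : D'.transverse =
      cyclotomicTransverse (W.torsionGaloisModule (((3 : ℕ) : ℤ) ^ j' * ((3 : ℕ) : ℤ))))
    (hD' : D'.HasCanonicalComparison (3 ^ (j' + 1)) η') :
    D'.IsCanonicalTauDatumThreeAtWith W m j' η' := by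
  obtain ⟨-, -, S, τ, hS, hτμ, hτq, hP⟩ := hD
  exact ⟨hT, hD', S, τ, hS, hτμ, hτq, hPP.trans hP⟩


/-! ### PORT″ — the shared-generator closure KEYED AT ONE PARAMETRISATION DATUM `P` (joint text of
lead R5-112 (a): p13 GEN 14 (ii-b) = planner r1 GEN 48 (3) with riders (α)(β); appended by the typer,
p18 GEN 10; the η-only PORT′ above is its parent closure, nothing landed is edited) -/

/-- **DICT3 @ 3, two-level form AT ONE PARAMETRISATION DATUM `P`** (`KatoKuriharaDictionaryThreeAt₂At`;
FLAG `K22-Thm3.13-PORT@3`; ledger rider R-a: the SAME debt line).  This is p09's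
`KatoKuriharaDictionaryThreeAt₂ W t k k′ D D′ red v₃` with EXACTLY the one binder line
`∀ {N : ℕ} [NeZero N] (P : ModularParametrizationData W N),` DELETED — `P` (and its level `N`) are
now PARAMETERS — and every other token kept VERBATIM: the antecedents `k ≤ k′`, the pin of `red`,
`Addv W 3`, `3 ∤ c₃`, surj(3), `#E(ℚ₃)[3] = 3^t`, `v₃ ∣ 3`, `3 ∤ c_P`, the period transfer (planner
r1's rider (α): the θ-road consumers read them; the ZetaBody road intro-discards them), and the
conclusion (the witnesses at both depths for `P` and (COMP)).  DESIGN CRITERION OF RECORD (lead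
R5-112 (a)): a port predicate is typed so that its NAMED DISCHARGER — ★ PK-6₂ from one `hbody` for
`P.f` + D7 + T-PK6-GEN ×2 — reaches it with no lemma the tree lacks: with `P` a parameter no
newform-identity lemma and no 'level = conductor' fact is needed (`hN : N = W.conductorNorm ℤ` is NOT a
clause here; it stays a binder of the discharger, rider (β)).  Nothing asserted.
[cite: Kim2022StructureSelmer, Thm. 3.13 and §2.2.2, §3.3–§3.4.1 (arXiv pp. 12, 17–18)]
[cite: MazurRubin2004, Def. 3.1.3, Thm. 3.2.4 and App. A (33)] [cite: Kato2004Asterisque, Thm. 12.5 (1)] -/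
def KatoKuriharaDictionaryThreeAt₂At (W : WeierstrassCurve ℚ) [W.IsElliptic] [W.IsGloballyMinimal]
    (t k k' : ℕ)
    (D : KolyvaginDatum (W.torsionGaloisModule (((3 : ℕ) : ℤ) ^ k * ((3 : ℕ) : ℤ))))
    (D' : KolyvaginDatum (W.torsionGaloisModule (((3 : ℕ) : ℤ) ^ k' * ((3 : ℕ) : ℤ))))
    (red : (W.torsionGaloisModule (((3 : ℕ) : ℤ) ^ k' * ((3 : ℕ) : ℤ))).toContRepresentation →ⁱL
      (W.torsionGaloisModule (((3 : ℕ) : ℤ) ^ k * ((3 : ℕ) : ℤ))).toContRepresentation)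
    (v₃ : HeightOneSpectrum (𝓞 ℚ)) {N : ℕ} [NeZero N] (P : ModularParametrizationData W N) : Prop :=
  haveI : Fact (Nat.Prime 3) := ⟨Nat.prime_three⟩
  k ≤ k' →
  -- `red` IS the reduction `x ↦ 3^{k′−k} x` (pinned on the underlying geometric points)
  (∀ x : geomTorsion W (((3 : ℕ) : ℤ) ^ k' * ((3 : ℕ) : ℤ)),
      ((red x : geomTorsion W (((3 : ℕ) : ℤ) ^ k * ((3 : ℕ) : ℤ))) : geomPoints W) =
        (((3 : ℕ) : ℤ) ^ (k' - k)) • (x : geomPoints W)) →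
  Addv W 3 → ¬ 3 ∣ (W.baseChange ℚ_[3]).localTamagawaNumber ℤ_[3] →
  W.HasSurjectiveModNGaloisRep ((3 : ℕ) : ℤ) →
  Nat.card {Q : (W.baseChange ℚ_[3]).toAffine.Point // (3 : ℕ) • Q = 0} = 3 ^ t →
  ((3 : ℕ) : 𝓞 ℚ) ∈ v₃.asIdeal →
    ¬ ((3 : ℕ) : ℤ) ∣ P.maninConstant →
    (∃ u : ℚ, ‖(u : ℚ_[3])‖ = 1 ∧ W.realPeriodRat = u * plusPeriod P.f) →
    ∃ (κ : Finset (HeightOneSpectrum (𝓞 ℚ)) →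
          galoisCohomology (W.torsionGaloisModule (((3 : ℕ) : ℤ) ^ k * ((3 : ℕ) : ℤ))) 1)
      (Λ : galoisCohomology ((W.torsionGaloisModule (((3 : ℕ) : ℤ) ^ k * ((3 : ℕ) : ℤ))).toLocal
          (Sum.inr v₃)) 1 →+ ZMod (3 ^ (k + 1)))
      (κ' : Finset (HeightOneSpectrum (𝓞 ℚ)) →
          galoisCohomology (W.torsionGaloisModule (((3 : ℕ) : ℤ) ^ k * ((3 : ℕ) : ℤ))) 1)
      (κu : Finset (HeightOneSpectrum (𝓞 ℚ)) →
          galoisCohomology (W.torsionGaloisModule (((3 : ℕ) : ℤ) ^ k' * ((3 : ℕ) : ℤ))) 1)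
      (Λu : galoisCohomology ((W.torsionGaloisModule (((3 : ℕ) : ℤ) ^ k' * ((3 : ℕ) : ℤ))).toLocal
          (Sum.inr v₃)) 1 →+ ZMod (3 ^ (k' + 1)))
      (κu' : Finset (HeightOneSpectrum (𝓞 ℚ)) →
          galoisCohomology (W.torsionGaloisModule (((3 : ℕ) : ℤ) ^ k' * ((3 : ℕ) : ℤ))) 1),
      KatoKuriharaWitnessAt W k t D v₃ P κ Λ κ' ∧
      KatoKuriharaWitnessAt W k' t D' v₃ P κu Λu κu' ∧
      -- (COMP) one Euler system: the depth-`k′` families reduce to the depth-`k` families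
      ∀ d, D'.IsLevel d → D.IsLevel d →
        galoisCohomology.map red 1 (κu d) = κ d ∧ galoisCohomology.map red 1 (κu' d) = κ' d

/-- **Projection**: DICT3₂ (the `∀ P` form) gives its `P`-keyed instance at every parametrisation
datum (`fun h P => h … P`, the antecedents threaded). [cite: Kim2022StructureSelmer, Thm. 3.13] -/
theorem KatoKuriharaDictionaryThreeAt₂.at [W.IsGloballyMinimal] {t k k' : ℕ}
    {D : KolyvaginDatum (W.torsionGaloisModule (((3 : ℕ) : ℤ) ^ k * ((3 : ℕ) : ℤ)))}
    {D' : KolyvaginDatum (W.torsionGaloisModule (((3 : ℕ) : ℤ) ^ k' * ((3 : ℕ) : ℤ)))}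
    {red : (W.torsionGaloisModule (((3 : ℕ) : ℤ) ^ k' * ((3 : ℕ) : ℤ))).toContRepresentation →ⁱL
      (W.torsionGaloisModule (((3 : ℕ) : ℤ) ^ k * ((3 : ℕ) : ℤ))).toContRepresentation}
    {v₃ : HeightOneSpectrum (𝓞 ℚ)} (h : KatoKuriharaDictionaryThreeAt₂ W t k k' D D' red v₃)
    {N : ℕ} [NeZero N] (P : ModularParametrizationData W N) :
    KatoKuriharaDictionaryThreeAt₂At W t k k' D D' red v₃ P :=
  fun hk hred hadd hc3 hsurj ht hv₃ hcP hper => h hk hred hadd hc3 hsurj ht hv₃ P hcP hper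

/-- **PORT″ — the shared-generator closure AT ONE PARAMETRISATION DATUM `P`
(`KatoKuriharaPortThreeAtWith₂`; FLAG `K22-Thm3.13-PORT@3`; NOT in print at `3`; a missing-input
predicate, to be ASSUMED by its consumer, never `_holds`; ledger rider R-a: the SAME debt line).**  For
`W/ℚ` globally minimal, `t`, `v₃`, ONE generator family `η` AND ONE parametrisation datum `P` (level
`N`): for all depths `k, k′`, all `τ`-data `D`, `D′` canonical for THE SAME `η` (With-guards at
`k + t`, `k′ + t`) and every `red`, the `P`-keyed two-level dictionary
`KatoKuriharaDictionaryThreeAt₂At W t k k′ D D′ red v₃ P`.  Joint text of lead R5-112 (a) (p13 GEN 14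
(ii-b) = planner r1 GEN 48 (3)): the NAMED DISCHARGER ★ PK-6₂ reads `(P) (hN : N = W.conductorNorm ℤ)
(hbody : ZetaBody W 3 P.f …) (D7 / T-PK6-GEN inputs) → KatoKuriharaPortThreeAtWith₂ W t v₃ η P` with
no newform-identity lemma and no displayed 'level = conductor' fact; the records' re-key spec (R-ii″,
DEFERRED per R5-110 (n3)(β)) is {`hPort : KatoKuriharaPortThreeAt W t v₃`} ↦ {`(η) (hη)
(hPort″ : KatoKuriharaPortThreeAtWith₂ W t v₃ η P)`} at the record's OWN `P`.  Nothing asserted.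
[cite: Kim2022StructureSelmer, Thm. 3.13 and §2.2.2, §3.3–§3.4.1 (arXiv pp. 12, 17–18)]
[cite: MazurRubin2004, Def. 3.1.3, Thm. 3.2.4 and App. A (33)] [cite: Kato2004Asterisque, Thm. 12.5 (1)] -/
def KatoKuriharaPortThreeAtWith₂ (W : WeierstrassCurve ℚ) [W.IsElliptic] [W.IsGloballyMinimal]
    (t : ℕ) (v₃ : HeightOneSpectrum (𝓞 ℚ))
    (η : (q : HeightOneSpectrum (𝓞 ℚ)) → (ZMod (Ideal.absNorm q.asIdeal))ˣ)
    {N : ℕ} [NeZero N] (P : ModularParametrizationData W N) : Prop :=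
  ∀ (k k' : ℕ) (D : KolyvaginDatum (W.torsionGaloisModule (((3 : ℕ) : ℤ) ^ k * ((3 : ℕ) : ℤ))))
    (D' : KolyvaginDatum (W.torsionGaloisModule (((3 : ℕ) : ℤ) ^ k' * ((3 : ℕ) : ℤ))))
    (red : (W.torsionGaloisModule (((3 : ℕ) : ℤ) ^ k' * ((3 : ℕ) : ℤ))).toContRepresentation →ⁱL
      (W.torsionGaloisModule (((3 : ℕ) : ℤ) ^ k * ((3 : ℕ) : ℤ))).toContRepresentation),
    D.IsCanonicalTauDatumThreeAtWith W (k + t) k η → D'.IsCanonicalTauDatumThreeAtWith W (k' + t) k' η →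
      KatoKuriharaDictionaryThreeAt₂At W t k k' D D' red v₃ P

/-- **PORT′ `η` ⟹ PORT″ `η P` for every `P`** (one line; the η-only closure is the parent).
[cite: Kim2022StructureSelmer, Thm. 3.13] -/
theorem KatoKuriharaPortThreeAtWith.toWith₂ [W.IsGloballyMinimal] {t : ℕ} {v₃ : HeightOneSpectrum (𝓞 ℚ)}
    {η : (q : HeightOneSpectrum (𝓞 ℚ)) → (ZMod (Ideal.absNorm q.asIdeal))ˣ}
    (h : KatoKuriharaPortThreeAtWith W t v₃ η) {N : ℕ} [NeZero N] (P : ModularParametrizationData W N) :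
    KatoKuriharaPortThreeAtWith₂ W t v₃ η P :=
  fun k k' D D' red hD hD' => (h k k' D D' red hD hD').at P

/-- **PORT ⟹ PORT″ `η P` for every `η`, `P`** (one line; the universal closure is a parent of both —
so the kernel refutation of PORT, n1011-p11's T-PORT-NEG, says nothing about PORT′/PORT″).
[cite: Kim2022StructureSelmer, Thm. 3.13] -/
theorem KatoKuriharaPortThreeAt.toWith₂ [W.IsGloballyMinimal] {t : ℕ} {v₃ : HeightOneSpectrum (𝓞 ℚ)}
    (h : KatoKuriharaPortThreeAt W t v₃)
    (η : (q : HeightOneSpectrum (𝓞 ℚ)) → (ZMod (Ideal.absNorm q.asIdeal))ˣ)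
    {N : ℕ} [NeZero N] (P : ModularParametrizationData W N) :
    KatoKuriharaPortThreeAtWith₂ W t v₃ η P :=
  (h.toWith η).toWith₂ P

/-- **Unpacking PORT″ to the END theorem's binder at the record's own `P`**: for a shallow datum `D`
at depth `k` and deep data `D′ k′`, ALL canonical for the SAME `η`, PORT″ gives
`∀ k′, k ≤ k′ → KatoKuriharaDictionaryThreeAt₂At W t k k′ D (D′ k′) (red k′) v₃ P` — the `P`-keyed
`hdict` that `Assembly.pow_dvd_natCard_selmerGroup_of_certificate` instantiates (it has `P` in scope).
[cite: Kim2022StructureSelmer, Thm. 3.13] -/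
theorem KatoKuriharaPortThreeAtWith₂.dictionary₂At [W.IsGloballyMinimal] {t : ℕ}
    {v₃ : HeightOneSpectrum (𝓞 ℚ)} {η : (q : HeightOneSpectrum (𝓞 ℚ)) → (ZMod (Ideal.absNorm q.asIdeal))ˣ}
    {N : ℕ} [NeZero N] {P : ModularParametrizationData W N}
    (h : KatoKuriharaPortThreeAtWith₂ W t v₃ η P) {k : ℕ}
    {D : KolyvaginDatum (W.torsionGaloisModule (((3 : ℕ) : ℤ) ^ k * ((3 : ℕ) : ℤ)))}
    (hD : D.IsCanonicalTauDatumThreeAtWith W (k + t) k η)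
    {D' : ∀ k' : ℕ, KolyvaginDatum (W.torsionGaloisModule (((3 : ℕ) : ℤ) ^ k' * ((3 : ℕ) : ℤ)))}
    (hD' : ∀ k', (D' k').IsCanonicalTauDatumThreeAtWith W (k' + t) k' η)
    (red : ∀ k' : ℕ, (W.torsionGaloisModule (((3 : ℕ) : ℤ) ^ k' * ((3 : ℕ) : ℤ))).toContRepresentation
      →ⁱL (W.torsionGaloisModule (((3 : ℕ) : ℤ) ^ k * ((3 : ℕ) : ℤ))).toContRepresentation) :
    ∀ k', k ≤ k' → KatoKuriharaDictionaryThreeAt₂At W t k k' D (D' k') (red k') v₃ P :=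
  fun k' _ => h k k' D (D' k') (red k') hD (hD' k')

end Summit.BirchSwinnertonDyer.Rank1Residual.GaloisImage

end
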